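import Summits.Langlands.Langlands.Theses.EvenSkinnerWilesMirror
import Literature.NumberTheory.Automorphic.BaseChangeArchimedean
import Literature.NumberTheory.Automorphic.ArchParameterUnique

/-!
# Birth skeleton of the piece X₁ `MirrorDescent` (child of crux stmt-Langlands-15309 `BianchiMirrorParity`)

Stubs: ONE new lemma (Galois-stability of the Satake data of `π` from its compatibility with a representation of
`Γ_ℚ`) and three NAMED FACTS of the tree (cyclic descent, the archimedean clause of strong lifting, existence of
infinity types); `MirrorDescent_of` composes them with the PROVED `isLAlgebraic_descent` and
`AutomorphicRepData.hasArchParameter_unique`, deriving `IsGalois ℚ K`, cyclicity and primality of the degree from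
`[K : ℚ] = 2`.
-/

set_option linter.dupNamespace false

namespace Summit.Langlands.Langlands.Cruxes.BianchiMirrorParity.MirrorDescentBirth

open Filter
open Literature.NumberTheory.Automorphic Literature.NumberTheory.GaloisRepresentations

/-- STUB (new lemma, M): the Satake data of `π` are `Gal(K/ℚ)`-stable almost everywhere when `π` is
Satake–Frobenius compatible with the restriction to `Γ_K` of a representation `ρ` of `Γ_ℚ` (at a split `v` the
Frobenius elements at `w` and `c(w)` are `Γ_ℚ`-conjugate, so `ρ` has the same characteristic polynomial at both,
and the Satake parameter is read off that polynomial — `hasSatakeParamAt_unique_holds`; at an inert `v` there is one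
`w`). [folklore] -/
theorem stub_isGaloisStableSatakeAE_of_compatible : ∀ (p : ℕ) [Fact p.Prime] (K : Type) [Field K] [NumberField K], Module.finrank ℚ K = 2 → ∀ (hcpt : Literature.NumberTheory.Automorphic.isCompact_glFiniteIntegralLevel 2 K) (ι : PadicAlgCl p ≃+* ℂ) (ρ : Literature.NumberTheory.GaloisRepresentations.FramedGaloisRep ℚ (PadicAlgCl p) 2) (π : Literature.NumberTheory.Automorphic.CuspidalAutomorphicRepData 2 K hcpt), (∀ᶠ w in cofinite, Summit.Langlands.SatakeFrobCompatibleAt ι π.1 (ρ.restrictField K) w) → Literature.NumberTheory.Automorphic.IsGaloisStableSatakeAE ℚ π.1 := by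
  sorry

/-- STUB-FACT F1: cyclic descent of prime degree, Arthur–Clozel III.4.2 (d) — the tree's named fact
`cuspidal_descent_cyclic`, undischarged. [cite: ArthurClozelAMS120, Ch. 3 Thm. 4.2 (d)] -/
theorem stub_fact_descent : cuspidal_descent_cyclic := by
  sorry

/-- STUB-FACT F2: the archimedean clause of strong lifting, Arthur–Clozel III.5.1 with Ch. 1 §7 — the tree's named
fact `ArthurClozel1989_strongLifting_archimedean`, undischarged. [cite: ArthurClozelAMS120, Ch. 3 Thm. 5.1 and Ch. 1 §7] -/
theorem stub_fact_archimedean : ArthurClozel1989_strongLifting_archimedean := by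
  sorry

/-- STUB-FACT F3: every cuspidal automorphic representation of `GL₂(𝔸_ℚ)` has an infinity type (Clozel 1990 §3.3;
the tree's per-datum named fact `AutomorphicRepData.exists_hasInfinityType`). [cite: Clozel1990, §3.3] -/
theorem stub_exists_hasInfinityType : ∀ (hℚ : Literature.NumberTheory.Automorphic.isCompact_glFiniteIntegralLevel 2 ℚ) (π₀ : Literature.NumberTheory.Automorphic.CuspidalAutomorphicRepData 2 ℚ hℚ), π₀.1.exists_hasInfinityType := by
  sorry

/-- **COMPOSITION (no sorry): the stubs imply X₁ `MirrorDescent`.**  `[K : ℚ] = 2` makes `K/ℚ` Galois with cyclic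
group of prime order `2`; the Satake data of `π` are Galois-stable (stub), so `π` descends to a cuspidal `π₀`
(F1); `π₀` is `L`-algebraic by `isLAlgebraic_descent` (F2 with F3 and the proved Harish-Chandra uniqueness
`AutomorphicRepData.hasArchParameter_unique`). [folklore] -/
theorem MirrorDescent_of :
    (∀ (p : ℕ) [Fact p.Prime] (K : Type) [Field K] [NumberField K], Module.finrank ℚ K = 2 → ∀ (hcpt : Literature.NumberTheory.Automorphic.isCompact_glFiniteIntegralLevel 2 K) (ι : PadicAlgCl p ≃+* ℂ) (ρ : Literature.NumberTheory.GaloisRepresentations.FramedGaloisRep ℚ (PadicAlgCl p) 2) (π : Literature.NumberTheory.Automorphic.CuspidalAutomorphicRepData 2 K hcpt), (∀ᶠ w in cofinite, Summit.Langlands.SatakeFrobCompatibleAt ι π.1 (ρ.restrictField K) w) → Literature.NumberTheory.Automorphic.IsGaloisStableSatakeAE ℚ π.1) →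
    cuspidal_descent_cyclic →
    ArthurClozel1989_strongLifting_archimedean →
    (∀ (hℚ : Literature.NumberTheory.Automorphic.isCompact_glFiniteIntegralLevel 2 ℚ) (π₀ : Literature.NumberTheory.Automorphic.CuspidalAutomorphicRepData 2 ℚ hℚ), π₀.1.exists_hasInfinityType) →
      (∀ (p : ℕ) [Fact p.Prime] (K : Type) [Field K] [NumberField K], NumberField.IsTotallyComplex K → Module.finrank ℚ K = 2 → ∀ (hcpt : Literature.NumberTheory.Automorphic.isCompact_glFiniteIntegralLevel 2 K) (hℚ : Literature.NumberTheory.Automorphic.isCompact_glFiniteIntegralLevel 2 ℚ) (ι : PadicAlgCl p ≃+* ℂ) (ρ : Literature.NumberTheory.GaloisRepresentations.FramedGaloisRep ℚ (PadicAlgCl p) 2) (π : Literature.NumberTheory.Automorphic.CuspidalAutomorphicRepData 2 K hcpt), π.1.IsLAlgebraic → (∀ᶠ w in cofinite, Summit.Langlands.SatakeFrobCompatibleAt ι π.1 (ρ.restrictField K) w) → ∃ π₀ : Literature.NumberTheory.Automorphic.CuspidalAutomorphicRepData 2 ℚ hℚ, π₀.1.IsLAlgebraic ∧ Literature.NumberTheory.Automorphic.IsWeakBaseChangeLiftAE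 π₀.1 π.1) := by
  intro hst hdesc harch hex
  intro p _ K _ _ hKc hK2 hcpt hℚ ι ρ π hπL hπsat
  haveI : FiniteDimensional ℚ K := Module.finite_of_finrank_eq_succ hK2
  haveI : Algebra.IsQuadraticExtension ℚ K := ⟨hK2⟩
  haveI : IsGalois ℚ K := inferInstance
  have hcyc : IsCyclic (K ≃ₐ[ℚ] K) :=
    isCyclic_of_prime_card (p := 2) (by rw [IsGalois.card_aut_eq_finrank, hK2])
  have hprime : (Module.finrank ℚ K).Prime := by rw [hK2]; exact Nat.prime_two
  obtain ⟨π₀, hBC⟩ := hdesc 2 ℚ K hℚ hcpt hcyc hprime π (hst p K hK2 hcpt ι ρ π hπsat)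
  refine ⟨π₀, ?_, hBC⟩
  exact ArthurClozel1989_strongLifting_archimedean.isLAlgebraic_descent harch hcyc hprime hBC (hex hℚ π₀)
    (fun χ χ' h h' => AutomorphicRepData.hasArchParameter_unique _ h h') hπL

/-- X₁ from the stubs. [folklore] -/
theorem mirrorDescent_of_stubs : (∀ (p : ℕ) [Fact p.Prime] (K : Type) [Field K] [NumberField K], NumberField.IsTotallyComplex K → Module.finrank ℚ K = 2 → ∀ (hcpt : Literature.NumberTheory.Automorphic.isCompact_glFiniteIntegralLevel 2 K) (hℚ : Literature.NumberTheory.Automorphic.isCompact_glFiniteIntegralLevel 2 ℚ) (ι : PadicAlgCl p ≃+* ℂ) (ρ : Literature.NumberTheory.GaloisRepresentations.FramedGaloisRep ℚ (PadicAlgCl p) 2) (π : Literature.NumberTheory.Automorphic.CuspidalAutomorphicRepData 2 K hcpt), π.1.IsLAlgebraic → (∀ᶠ w in cofinite, Summit.Langlands.SatakeFrobCompatibleAt ι π.1 (ρ.restrictField K) w) → ∃ π₀ : Literature.NumberTheory.Automorphic.CuspidalAutomorphicRepData 2 ℚ hℚ, π₀.1.IsLAlgebraic ∧ Literature.NumberTheory.Automorphic.IsWeakBaseChangeLiftAE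 π₀.1 π.1) :=
  MirrorDescent_of stub_isGaloisStableSatakeAE_of_compatible stub_fact_descent stub_fact_archimedean
    stub_exists_hasInfinityType

end Summit.Langlands.Langlands.Cruxes.BianchiMirrorParity.MirrorDescentBirth
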